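import Summits.AtomisticToContinuum.FouriersLaw.Theorems.BondHeatUncertaintyLightConeBondHeatBondCorrelation
import Summits.AtomisticToContinuum.FouriersLaw.Theorems.BondHeatUncertaintySubdiffusiveBondHeatBathBondReductionVariance
import Summits.AtomisticToContinuum.FouriersLaw.Theorems.BondHeatUncertaintySubdiffusiveBondHeatBathBondReductionCorrelations

/-!
# `V_N(b,t) ≥ 0` and the decay of the running Green–Kubo integral contained in `LightConeBondHeat`

Support file for item `stmt-AtomisticToContinuum-9123` (`BondHeatUncertainty.LightConeBondHeat`, (S_lc)).  For the
pinned anharmonic chain `pinnedChain ω₂ lam β γ` (`ω₂ > 0`, `lam ≥ 0`, `β, γ > 0`, `N ≥ 1`, `T > 0`) and every bond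
`i`, with `C_N(i,s) = ∫ j_i · (P_{s⁺} j_i) dμ_T` and `V_N(i,t) = 2∫₀ᵗ (t−s) C_N(i,s) ds`:

* `pinnedChain_bondHeatVar_eq_integral_sq` — `V_N(i,t) = E_{μ_T ⊗ W}[(∫₀ᵗ j_i(z_s) ds)²]` (`t ≥ 0`): the kernel-level
  functional of the route items IS the second moment of the time-integrated bond current along the stationary
  constructed flow (the dictionary `pinnedChain_integral_sq_intervalIntegral_of_invariant` of the bath-bond reduction,
  fed with the kernel Gibbs invariance `pinnedChain_gibbsMeasure_bind_transitionKernel` and `j_i ∈ L²(μ_T)`);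
* `pinnedChain_bondHeatVar_nonneg`, `pinnedChain_bondHeatVar_dite_nonneg` — hence **`V_N(i,t) ≥ 0`** (also in the
  `dite` spelling of the items, at every `b : ℕ`);
* `pinnedChain_bondHeatVar_eq_integral_runningGK` — `V_N(i,t) = 2∫₀ᵗ D_N(i,u) du` with the RUNNING GREEN–KUBO
  INTEGRAL `D_N(i,u) = ∫₀ᵘ C_N(i,s) ds` (triangle identity);
* `pinnedChain_exists_runningGK_le` — so a bound `V_N(i,t) ≤ B` at one time `t > 0` forces
  `min_{u ∈ [t/2,t]} D_N(i,u) ≤ B/t` (`V_N(i,t) − V_N(i,t/2) = 2∫_{t/2}^t D_N(i,·)` and `V_N(i,t/2) ≥ 0`);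
* **`lightConeBondHeat_runningGK_dip`** — consequently (S_lc) CONTAINS quantitative sub-ballisticity: under
  `LightConeBondHeat`, for all large `N` some bond `b` has, for every `t ∈ [2, a·N]`, a time `u ∈ [t/2, t]` with
  `∫₀ᵘ C_N(b,s) ds ≤ A/√t` — the running single-bond Green–Kubo integral must dip to `O(t^{-1/2})` all the way up
  to times of order `N`, uniformly in `N`.  (At fixed `N`, `∫₀^∞ C_N(b,·)` is the Green–Kubo saturation value, so
  this is the statement that (S_lc) already forces conductance decay `O(N^{-1/2})` inside its window; it is recorded
  here as a necessary condition that any proof or refutation of (S_lc) at a bulk bond has to respect.)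
-/

noncomputable section

open MeasureTheory ProbabilityTheory Filter Topology Set
open scoped NNReal ENNReal

namespace Summit.AtomisticToContinuum.FouriersLaw.Theorems.LightConeBondHeat

open Literature.MathematicalPhysics.KineticTheory.HeatConduction
open Literature.MathematicalPhysics.KineticTheory Literature.Probability.Process OscillatorChain
open Summit.AtomisticToContinuum.FouriersLaw.Theorems.SubdiffusiveBondHeat
open Summit.AtomisticToContinuum.FouriersLaw.Theses.BondHeatUncertainty

section Fixed

variable {ω₂ lam β γ : ℝ} (hω : 0 < ω₂) (hl : 0 ≤ lam) (hβ : 0 < β) (hγ : 0 < γ) {N : ℕ} (hN : 0 < N)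
  {T : ℝ} (hT : 0 < T)
include hω hl hβ hγ hN hT

/-- **`V_N(i,t) = E[(∫₀ᵗ j_i(z_s) ds)²]`** (`t ≥ 0`): the bond-heat variance functional of the route items is the
second moment of the time-integrated bond current along the stationary constructed flow `z_s = Φ_s(x,B)`,
`x ∼ μ_T` (kernel Gibbs invariance + the second-moment dictionary of the bath-bond reduction). [folklore] -/
theorem pinnedChain_bondHeatVar_eq_integral_sq (i : Fin N) {t : ℝ} (ht : 0 ≤ t) :
    2 * ∫ s in (0:ℝ)..t, (t - s) * ∫ z, (pinnedChain ω₂ lam β γ).bondCurrent N i z *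
        (∫ y, (pinnedChain ω₂ lam β γ).bondCurrent N i y
          ∂((pinnedChain ω₂ lam β γ).transitionKernel N T T s.toNNReal z))
      ∂((pinnedChain ω₂ lam β γ).gibbsMeasure N T) =
    ∫ p, (∫ s in (0 : ℝ)..t, (pinnedChain ω₂ lam β γ).bondCurrent N i
        ((pinnedChain ω₂ lam β γ).solMap N T T s p.1 (pairPath p.2))) ^ 2
      ∂(((pinnedChain ω₂ lam β γ).gibbsMeasure N T).prod wienerPair) := by
  haveI := pinnedChain_isProbabilityMeasure_gibbsMeasure hω hl hβ.le γ N hT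
  exact (pinnedChain_integral_sq_intervalIntegral_of_invariant hω hl hβ.le hγ.le N T T
    ((pinnedChain ω₂ lam β γ).gibbsMeasure N T)
    (fun s => pinnedChain_gibbsMeasure_bind_transitionKernel hω hl hβ.le hγ.le hN hT s)
    (pinnedChain_continuous_bondCurrent ω₂ lam β γ N i).measurable
    (pinnedChain_integrable_sq_bondCurrent hω hl hβ hγ hN hT i) ht).symm

/-- **`V_N(i,t) ≥ 0`** for `t ≥ 0`: the bond-heat variance functional is a second moment. [folklore] -/
theorem pinnedChain_bondHeatVar_nonneg (i : Fin N) {t : ℝ} (ht : 0 ≤ t) :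
    0 ≤ 2 * ∫ s in (0:ℝ)..t, (t - s) * ∫ z, (pinnedChain ω₂ lam β γ).bondCurrent N i z *
        (∫ y, (pinnedChain ω₂ lam β γ).bondCurrent N i y
          ∂((pinnedChain ω₂ lam β γ).transitionKernel N T T s.toNNReal z))
      ∂((pinnedChain ω₂ lam β γ).gibbsMeasure N T) := by
  rw [pinnedChain_bondHeatVar_eq_integral_sq hω hl hβ hγ hN hT i ht]
  exact integral_nonneg fun p => sq_nonneg _

omit hN in
/-- **`V N b t ≥ 0` in the spelling of the route items** (S) `SubdiffusiveBondHeat` / (S_lc) `LightConeBondHeat`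
(`C N b s := if h : b < N then ∫ j_b · P_s j_b dμ_T else 0`, `V N b t := 2∫₀ᵗ (t−s) C N b s`), for every `b : ℕ` and
`t ≥ 0`. [folklore] -/
theorem pinnedChain_bondHeatVar_dite_nonneg (b : ℕ) {t : ℝ} (ht : 0 ≤ t) :
    0 ≤ 2 * ∫ s in (0:ℝ)..t, (t - s) *
        (if h : b < N then
          ∫ z, (pinnedChain ω₂ lam β γ).bondCurrent N ⟨b, h⟩ z *
              (∫ y, (pinnedChain ω₂ lam β γ).bondCurrent N ⟨b, h⟩ y
                ∂((pinnedChain ω₂ lam β γ).transitionKernel N T T s.toNNReal z))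
            ∂((pinnedChain ω₂ lam β γ).gibbsMeasure N T)
        else 0) := by
  by_cases hb : b < N
  · simp only [dif_pos hb]
    exact pinnedChain_bondHeatVar_nonneg hω hl hβ hγ (lt_of_le_of_lt (Nat.zero_le b) hb) hT ⟨b, hb⟩ ht
  · simp [dif_neg hb]

/-- **`V_N(i,t) = 2∫₀ᵗ D_N(i,u) du`** with the running Green–Kubo integral `D_N(i,u) = ∫₀ᵘ C_N(i,s) ds` (`t ≥ 0`;
the triangle identity `∫₀ᵗ∫₀ᵘ = ∫₀ᵗ (t − s)`). [folklore] -/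
theorem pinnedChain_bondHeatVar_eq_integral_runningGK (i : Fin N) {t : ℝ} (ht : 0 ≤ t) :
    2 * ∫ s in (0:ℝ)..t, (t - s) * ∫ z, (pinnedChain ω₂ lam β γ).bondCurrent N i z *
        (∫ y, (pinnedChain ω₂ lam β γ).bondCurrent N i y
          ∂((pinnedChain ω₂ lam β γ).transitionKernel N T T s.toNNReal z))
      ∂((pinnedChain ω₂ lam β γ).gibbsMeasure N T) =
    2 * ∫ u in (0:ℝ)..t, ∫ s in (0:ℝ)..u, ∫ z, (pinnedChain ω₂ lam β γ).bondCurrent N i z *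
        (∫ y, (pinnedChain ω₂ lam β γ).bondCurrent N i y
          ∂((pinnedChain ω₂ lam β γ).transitionKernel N T T s.toNNReal z))
      ∂((pinnedChain ω₂ lam β γ).gibbsMeasure N T) := by
  haveI := pinnedChain_isProbabilityMeasure_gibbsMeasure hω hl hβ.le γ N hT
  rw [pinnedChain_integral_integral_kernelPairing_triangle hω hl hβ.le hγ.le N T T
    ((pinnedChain ω₂ lam β γ).gibbsMeasure N T)
    (fun s => pinnedChain_gibbsMeasure_bind_transitionKernel hω hl hβ.le hγ.le hN hT s)
    (pinnedChain_continuous_bondCurrent ω₂ lam β γ N i).measurable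
    (pinnedChain_continuous_bondCurrent ω₂ lam β γ N i).measurable
    (pinnedChain_integrable_sq_bondCurrent hω hl hβ hγ hN hT i)
    (pinnedChain_integrable_sq_bondCurrent hω hl hβ hγ hN hT i) ht]

/-- **A bound on `V_N(i,t)` forces a dip of the running Green–Kubo integral**: if `V_N(i,t) ≤ B` at some `t > 0`,
then `∫₀ᵘ C_N(i,s) ds ≤ B/t` for some `u ∈ [t/2, t]` — because `V_N(i,t) − V_N(i,t/2) = 2∫_{t/2}^t D_N(i,u) du`,
`V_N(i,t/2) ≥ 0`, and `D_N(i,·)` is continuous. [folklore] -/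
theorem pinnedChain_exists_runningGK_le (i : Fin N) {t B : ℝ} (ht : 0 < t)
    (hV : 2 * ∫ s in (0:ℝ)..t, (t - s) * ∫ z, (pinnedChain ω₂ lam β γ).bondCurrent N i z *
        (∫ y, (pinnedChain ω₂ lam β γ).bondCurrent N i y
          ∂((pinnedChain ω₂ lam β γ).transitionKernel N T T s.toNNReal z))
      ∂((pinnedChain ω₂ lam β γ).gibbsMeasure N T) ≤ B) :
    ∃ u : ℝ, t / 2 ≤ u ∧ u ≤ t ∧
      ∫ s in (0:ℝ)..u, ∫ z, (pinnedChain ω₂ lam β γ).bondCurrent N i z *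
          (∫ y, (pinnedChain ω₂ lam β γ).bondCurrent N i y
            ∂((pinnedChain ω₂ lam β γ).transitionKernel N T T s.toNNReal z))
        ∂((pinnedChain ω₂ lam β γ).gibbsMeasure N T) ≤ B / t := by
  set C : ℝ → ℝ := fun s => ∫ z, (pinnedChain ω₂ lam β γ).bondCurrent N i z *
      (∫ y, (pinnedChain ω₂ lam β γ).bondCurrent N i y
        ∂((pinnedChain ω₂ lam β γ).transitionKernel N T T s.toNNReal z))
    ∂((pinnedChain ω₂ lam β γ).gibbsMeasure N T) with hC_def
  have hC : Continuous C := pinnedChain_continuous_bondCorr hω hl hβ hγ hN hT i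
  set D : ℝ → ℝ := fun u => ∫ s in (0:ℝ)..u, C s with hD_def
  have hD : Continuous D := intervalIntegral.continuous_primitive (fun a b => hC.intervalIntegrable a b) 0
  have ht2 : t / 2 ≤ t := by linarith
  -- the minimum of `D` on `[t/2, t]`
  obtain ⟨u₀, hu₀, hmin⟩ :=
    (isCompact_Icc (a := t / 2) (b := t)).exists_isMinOn (nonempty_Icc.2 ht2) hD.continuousOn
  refine ⟨u₀, hu₀.1, hu₀.2, ?_⟩
  -- `V(t) = 2∫₀ᵗ D`, `V(t/2) = 2∫₀^{t/2} D ≥ 0`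
  have hVt : 2 * ∫ s in (0:ℝ)..t, (t - s) * C s = 2 * ∫ u in (0:ℝ)..t, D u :=
    pinnedChain_bondHeatVar_eq_integral_runningGK hω hl hβ hγ hN hT i ht.le
  have hVhalf : 0 ≤ 2 * ∫ u in (0:ℝ)..(t / 2), D u := by
    rw [← pinnedChain_bondHeatVar_eq_integral_runningGK hω hl hβ hγ hN hT i (by linarith : (0:ℝ) ≤ t / 2)]
    exact pinnedChain_bondHeatVar_nonneg hω hl hβ hγ hN hT i (by linarith)
  have hsplit : ∫ u in (0:ℝ)..t, D u = (∫ u in (0:ℝ)..(t / 2), D u) + ∫ u in (t / 2)..t, D u :=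
    (intervalIntegral.integral_add_adjacent_intervals (hD.intervalIntegrable _ _) (hD.intervalIntegrable _ _)).symm
  -- `∫_{t/2}^t D ≥ (t/2) · D u₀`
  have hlow : (t - t / 2) * D u₀ ≤ ∫ u in (t / 2)..t, D u := by
    have h1 : ∫ _ in (t / 2)..t, D u₀ = (t - t / 2) * D u₀ := by
      rw [intervalIntegral.integral_const, smul_eq_mul]
    rw [← h1]
    exact intervalIntegral.integral_mono_on ht2 intervalIntegrable_const (hD.intervalIntegrable _ _)
      fun x hx => hmin hx
  have hmain : t * D u₀ ≤ B := by
    have := hV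
    rw [hVt, hsplit] at this
    nlinarith
  rw [le_div_iff₀ ht]
  linarith

end Fixed

/-- **(S_lc) contains quantitative sub-ballisticity.**  Under `LightConeBondHeat` (the `N`-uniform `√t` law of the
bond-heat variance on the light-cone window `[1, a·N]`), for every chain length `N ≥ N₀` the distinguished bond `b`
satisfies: for every `t ∈ [2, a·N]` there is a time `u ∈ [t/2, t]` at which the RUNNING GREEN–KUBO INTEGRAL of the
single-bond current is small, `∫₀ᵘ C_N(b,s) ds ≤ A/√t` — with the SAME `N`-independent constants `A, a, N₀`
(`V_N(b,t) − V_N(b,t/2) = 2∫_{t/2}^t D_N(b,·)`, `V_N ≥ 0`).  So any proof of (S_lc) proves `t^{-1/2}`-decay of the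
running single-bond Green–Kubo integral up to times of order `N`, and any mechanism keeping `∫₀ᵘ C_N(b,·) ≥ c > 0`
on a window `[t/2, t]` with `t ≤ a·N`, `c√t > A`, at every bulk bond refutes it. [folklore] -/
theorem lightConeBondHeat_runningGK_dip (hS : LightConeBondHeat) :
    ∀ ω₂ lam β γ : ℝ, 0 < ω₂ → 0 < lam → 0 < β → 0 < γ → ∀ T : ℝ, 0 < T →
      (let P := pinnedChain ω₂ lam β γ
       let C : ℕ → ℕ → ℝ → ℝ := fun N b s => if h : b < N then ∫ z, P.bondCurrent N ⟨b, h⟩ z *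
         (∫ y, P.bondCurrent N ⟨b, h⟩ y ∂(P.transitionKernel N T T s.toNNReal z)) ∂(P.gibbsMeasure N T) else 0
       ∃ A a : ℝ, 0 < a ∧ ∃ N₀ : ℕ, ∀ N : ℕ, N₀ ≤ N → ∃ b : ℕ, b + 1 < N ∧
         ∀ t : ℝ, 2 ≤ t → t ≤ a * (N : ℝ) → ∃ u : ℝ, t / 2 ≤ u ∧ u ≤ t ∧
           ∫ s in (0:ℝ)..u, C N b s ≤ A / Real.sqrt t) := by
  intro ω₂ lam β γ hω hl hβ hγ T hT
  obtain ⟨A, a, ha, N₀, hN₀⟩ := hS ω₂ lam β γ hω hl hβ hγ T hT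
  refine ⟨A, a, ha, N₀, fun N hN => ?_⟩
  obtain ⟨b, hb, hV⟩ := hN₀ N hN
  refine ⟨b, hb, fun t h2 htN => ?_⟩
  have hbN : b < N := by omega
  have hNpos : 0 < N := by omega
  have ht : 0 < t := by linarith
  have hVt : 2 * ∫ s in (0:ℝ)..t, (t - s) * ∫ z, (pinnedChain ω₂ lam β γ).bondCurrent N ⟨b, hbN⟩ z *
      (∫ y, (pinnedChain ω₂ lam β γ).bondCurrent N ⟨b, hbN⟩ y
        ∂((pinnedChain ω₂ lam β γ).transitionKernel N T T s.toNNReal z))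
      ∂((pinnedChain ω₂ lam β γ).gibbsMeasure N T) ≤ A * Real.sqrt t := by
    simpa [dif_pos hbN] using hV t (by linarith) htN
  obtain ⟨u, hu1, hu2, hle⟩ := pinnedChain_exists_runningGK_le hω hl.le hβ hγ hNpos hT ⟨b, hbN⟩ ht hVt
  refine ⟨u, hu1, hu2, ?_⟩
  have hAt : A * Real.sqrt t / t = A / Real.sqrt t := by
    rw [div_eq_div_iff ht.ne' (Real.sqrt_pos.2 ht).ne', mul_assoc, Real.mul_self_sqrt ht.le]
  simpa [dif_pos hbN, hAt] using hle

end Summit.AtomisticToContinuum.FouriersLaw.Theorems.LightConeBondHeat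

end
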